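import Summits.CriticalPhenomena.CardyFormulaZ2.Theorems.CardyBoundaryCoulombGasRectilinearCardyStubKernelWindowLawPart1
import Summits.CriticalPhenomena.CardyFormulaZ2.Theorems.CardyBoundaryCoulombGasRectilinearCardyTailNoAtom
import HarnessLib

/-!
# Stub `stub_kernelWindowLaw` of line `excursion-kernel-covariance`, part 2: the boundary row of the
# closure discretisation along a straight side
# (crux `RectilinearCardy`, stmt-CriticalPhenomena-5660, route `CardyBoundaryCoulombGas`)

Lattice geometry of the closure discretisation `V_δ = closureFinset R δ` near a straight side
`{nrmC o = h}` of the conformal rectangle `R` (the window frame of part 1: inside `B(x, r)`,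
`Ω̄ = {nrmC o ≥ h}`), at a fixed mesh `δ`:

* `kwl_mem_closureFinset_iff_nrm` — near the side, membership in `V_δ` is `h ≤ δ · nrm o v`;
* `kwl_mem_boundaryRow_of_nrm` / `kwl_nrm_eq_of_mem_boundaryRow` — near the side, the boundary row
  (`boundaryRow`: exactly one lattice neighbour outside `V_δ`) is EXACTLY the lattice line
  `nrm o v = ⌈h/δ⌉` (the first lattice line inside `Ω̄`; its neighbour across the side is outside,
  the three others inside — the argument of the landed `kpa_exists_rowVertex_of_orient` and of the
  tree's `window_of_oneSided_ge`);
* `kwl_infDist_frontier_le_of_mem_boundaryRow` — a boundary-row vertex is within `δ` of `∂Ω` (the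
  mesh edge to its outside neighbour crosses `∂Ω`);
* `kwl_mem_rowTail_iff` — **the closest-arc rule along the side**: a row vertex whose foot (orthogonal
  projection on the side) is the window point `∂Ω(u)` is attributed to the tail arc `∂Ω[s, d]`
  (`rowTail`) iff `s ≤ u` (the foot is the unique nearest frontier point);
* `kwl_infDist_window_le` — a vertex attributed to `∂Ω[s, d]` but not to `∂Ω[s', d]` is at least as
  close to the window `∂Ω([s, s'])` as to the whole frontier (with the landed `infDist_union_eq_min`).

All [folklore] lattice bookkeeping.
-/

noncomputable section

open Set Filter Topology Metric
open Literature.Probability.RandomPlanarGeometry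
open Literature.Probability.LatticeModels (Site meshPoint zdGraph Orient cornerUnit
  dist_meshPoint_add_cornerUnit)

namespace Summit.CriticalPhenomena.CardyFormulaZ2.Cruxes.RectilinearCardy.ExcursionKernelCovariance

/-! ### The boundary row along a straight side -/

/-- Near the side, membership in `V_δ` is decided by the normal lattice coordinate. [folklore] -/
theorem kwl_mem_closureFinset_iff_nrm (R : ConformalRectangle) {o : Orient} {h r : ℝ} {x : ℂ}
    (hcl : ∀ z, dist z x < r → (z ∈ closure R.carrier ↔ h ≤ Orient.nrmC o z)) {δ : ℝ} (hδ : 0 < δ)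
    {u : Site 2} (hu : dist (meshPoint δ u) x < r) :
    u ∈ closureFinset R δ ↔ h ≤ δ * (Orient.nrm o u : ℝ) := by
  rw [mem_closureFinset_iff R hδ, hcl _ hu, Orient.nrmC_meshPoint]

/-- The two rounding inequalities of the row index `m = ⌈h/δ⌉`: `δ(m-1) < h ≤ δm`. [folklore] -/
theorem kwl_ceil_bounds {h δ : ℝ} (hδ : 0 < δ) :
    h ≤ δ * (⌈h / δ⌉ : ℝ) ∧ δ * ((⌈h / δ⌉ : ℝ) - 1) < h := by
  constructor
  · have := Int.le_ceil (h / δ)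
    rw [div_le_iff₀ hδ] at this
    linarith
  · have h1 := Int.ceil_lt_add_one (h / δ)
    have h' : (⌈h / δ⌉ : ℝ) - 1 < h / δ := by linarith
    rw [lt_div_iff₀ hδ] at h'
    linarith

/-- The normal lattice coordinate of a lattice neighbour, in the straightening frame. [folklore] -/
theorem kwl_nrm_add_cornerUnit (o : Orient) :
    ∃ perm : Equiv.Perm (Fin 4), ∀ (v : Site 2) (k : Fin 4),
      Orient.nrm o (v + cornerUnit k) = Orient.nrm o v + cornerUnit (perm k) 1 := by
  obtain ⟨perm, hperm⟩ := Orient.isLatticeMotion_frame o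
  refine ⟨perm, fun v k => ?_⟩
  rw [← Orient.frame_apply_one, hperm v k, Pi.add_apply, Orient.frame_apply_one]

/-- Mesh points of lattice neighbours of a vertex `δ`-inside `B(x, r)` are inside `B(x, r)`.
[folklore] -/
theorem kwl_dist_add_cornerUnit_lt {δ r : ℝ} (hδ : 0 < δ) {x : ℂ} {v : Site 2}
    (hdist : dist (meshPoint δ v) x + δ < r) (k : Fin 4) : dist (meshPoint δ (v + cornerUnit k)) x < r :=
  calc dist (meshPoint δ (v + cornerUnit k)) x
      ≤ dist (meshPoint δ (v + cornerUnit k)) (meshPoint δ v) + dist (meshPoint δ v) x :=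
        dist_triangle _ _ _
    _ = δ + dist (meshPoint δ v) x := by rw [dist_meshPoint_add_cornerUnit hδ]
    _ < r := by linarith

/-- **Row vertices are boundary-row vertices.** Near the side (`dist(δv, x) + δ < r`), a vertex on
the lattice line `nrm o v = ⌈h/δ⌉` lies in `V_δ` and has exactly one lattice neighbour outside `V_δ`
(the one across the side). [folklore] -/
theorem kwl_mem_boundaryRow_of_nrm (R : ConformalRectangle) {o : Orient} {h r : ℝ} {x : ℂ}
    (hcl : ∀ z, dist z x < r → (z ∈ closure R.carrier ↔ h ≤ Orient.nrmC o z)) {δ : ℝ} (hδ : 0 < δ)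
    {v : Site 2} (hv : Orient.nrm o v = ⌈h / δ⌉) (hdist : dist (meshPoint δ v) x + δ < r) :
    v ∈ boundaryRow R δ := by
  -- adapted from `kpa_exists_rowVertex_of_orient` (StubKernelPointAsymptoticsPart1)
  classical
  obtain ⟨hm1, hm2⟩ := kwl_ceil_bounds (h := h) hδ
  have hmem : ∀ u : Site 2, dist (meshPoint δ u) x < r →
      (u ∈ closureFinset R δ ↔ h ≤ δ * (Orient.nrm o u : ℝ)) :=
    fun u hu => kwl_mem_closureFinset_iff_nrm R hcl hδ hu
  have hvV : v ∈ closureFinset R δ :=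
    (hmem v (by linarith [dist_nonneg (x := meshPoint δ v) (y := x)])).2 (by rw [hv]; exact hm1)
  obtain ⟨perm, hperm⟩ := kwl_nrm_add_cornerUnit o
  have hnrm_step : ∀ k : Fin 4,
      (Orient.nrm o (v + cornerUnit k) : ℝ) = (⌈h / δ⌉ : ℝ) + ((cornerUnit (perm k) 1 : ℤ) : ℝ) := by
    intro k
    rw [hperm v k, hv]
    push_cast
    rfl
  set k₀ : Fin 4 := perm.symm 3 with hk₀
  have hk₀' : perm k₀ = 3 := by rw [hk₀, Equiv.apply_symm_apply]
  have hout : v + cornerUnit k₀ ∉ closureFinset R δ := by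
    rw [hmem _ (kwl_dist_add_cornerUnit_lt hδ hdist k₀), hnrm_step k₀, hk₀', not_le]
    have : ((cornerUnit 3 1 : ℤ) : ℝ) = -1 := by simp [cornerUnit]
    rw [this]
    linarith
  have hin : ∀ k : Fin 4, k ≠ k₀ → v + cornerUnit k ∈ closureFinset R δ := by
    intro k hk
    rw [hmem _ (kwl_dist_add_cornerUnit_lt hδ hdist k), hnrm_step k]
    have hk' : perm k ≠ 3 := fun h => hk (by rw [hk₀, ← h, Equiv.symm_apply_apply])
    have hc : (0 : ℤ) ≤ cornerUnit (perm k) 1 := by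
      generalize perm k = k' at hk' ⊢
      fin_cases k' <;> simp [cornerUnit] at hk' ⊢
    have hc' : (0 : ℝ) ≤ ((cornerUnit (perm k) 1 : ℤ) : ℝ) := by exact_mod_cast hc
    rw [mul_add]
    linarith [mul_nonneg hδ.le hc']
  refine (mem_boundaryRow_iff R).2 ⟨hvV, ?_⟩
  rw [Finset.card_eq_one]
  refine ⟨v + cornerUnit k₀, Finset.ext fun u => ?_⟩
  rw [Finset.mem_filter, SimpleGraph.mem_neighborFinset, Finset.mem_singleton]
  constructor
  · rintro ⟨hadj, huV⟩
    obtain ⟨k, rfl⟩ :=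
      Literature.Probability.LatticeModels.WeakBeurling.exists_eq_add_cornerUnit_of_adj hadj
    by_contra hne
    exact huV (hin k fun h => hne (by rw [h]))
  · rintro rfl
    exact ⟨Literature.Probability.Percolation.adj_of_stepKind
      (Literature.Probability.LatticeModels.WeakBeurling.stepKind_add_cornerUnit v k₀), hout⟩

/-- **Boundary-row vertices near the side are row vertices**: `nrm o v = ⌈h/δ⌉` (`v ∈ V_δ` gives
`h ≤ δ nrm v`; if `h ≤ δ(nrm v - 1)` all four neighbours would be in `V_δ`). [folklore] -/
theorem kwl_nrm_eq_of_mem_boundaryRow (R : ConformalRectangle) {o : Orient} {h r : ℝ} {x : ℂ}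
    (hcl : ∀ z, dist z x < r → (z ∈ closure R.carrier ↔ h ≤ Orient.nrmC o z)) {δ : ℝ} (hδ : 0 < δ)
    {v : Site 2} (hv : v ∈ boundaryRow R δ) (hdist : dist (meshPoint δ v) x + δ < r) :
    Orient.nrm o v = ⌈h / δ⌉ := by
  -- adapted from `window_of_oneSided_ge` (FlatBoundaryLatticeWindow)
  obtain ⟨hvV, hcard⟩ := (mem_boundaryRow_iff R).1 hv
  have hmem : ∀ u : Site 2, dist (meshPoint δ u) x < r →
      (u ∈ closureFinset R δ ↔ h ≤ δ * (Orient.nrm o u : ℝ)) :=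
    fun u hu => kwl_mem_closureFinset_iff_nrm R hcl hδ hu
  have hv1 : h ≤ δ * (Orient.nrm o v : ℝ) :=
    (hmem v (by linarith [dist_nonneg (x := meshPoint δ v) (y := x)])).1 hvV
  have hv2 : δ * ((Orient.nrm o v : ℝ) - 1) < h := by
    by_contra hge
    rw [not_lt] at hge
    obtain ⟨perm, hperm⟩ := kwl_nrm_add_cornerUnit o
    have hall : ∀ k : Fin 4, v + cornerUnit k ∈ closureFinset R δ := by
      intro k
      rw [hmem _ (kwl_dist_add_cornerUnit_lt hδ hdist k), hperm v k]
      have hc : (-1 : ℤ) ≤ cornerUnit (perm k) 1 := by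
        generalize perm k = k'
        fin_cases k' <;> simp [cornerUnit]
      have hc' : (-1 : ℝ) ≤ ((cornerUnit (perm k) 1 : ℤ) : ℝ) := by exact_mod_cast hc
      push_cast
      nlinarith
    have h0 : (((zdGraph 2).neighborFinset v).filter (fun u => u ∉ closureFinset R δ)).card = 0 := by
      rw [Finset.card_eq_zero, Finset.filter_eq_empty_iff]
      intro u hu
      rw [SimpleGraph.mem_neighborFinset] at hu
      obtain ⟨k, rfl⟩ :=
        Literature.Probability.LatticeModels.WeakBeurling.exists_eq_add_cornerUnit_of_adj hu
      rw [not_not]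
      exact hall k
    omega
  symm
  rw [Int.ceil_eq_iff]
  constructor
  · rw [lt_div_iff₀ hδ]; linarith
  · rw [div_le_iff₀ hδ]; linarith

/-- **A boundary-row vertex is within `δ` of the frontier**: the mesh edge to its outside neighbour
runs from `Ω̄` to the exterior, so it crosses `∂Ω`. [folklore] -/
theorem kwl_infDist_frontier_le_of_mem_boundaryRow (R : ConformalRectangle) {δ : ℝ} (hδ : 0 < δ)
    {v : Site 2} (hv : v ∈ boundaryRow R δ) : infDist (meshPoint δ v) (frontier R.carrier) ≤ δ := by
  obtain ⟨hvV, hcard⟩ := (mem_boundaryRow_iff R).1 hv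
  obtain ⟨u, hu⟩ := Finset.card_pos.1 (by rw [hcard]; exact one_pos)
  rw [Finset.mem_filter, SimpleGraph.mem_neighborFinset] at hu
  obtain ⟨hadj, huV⟩ := hu
  rw [mem_closureFinset_iff R hδ] at hvV huV
  obtain ⟨w, hw, hwf⟩ := Literature.Probability.Percolation.exists_mem_segment_frontier
    isClosed_closure.isOpen_compl (a := meshPoint δ u) (b := meshPoint δ v) huV
    (fun hsub => hsub (right_mem_segment ℝ _ _) hvV)
  have hwf' : w ∈ frontier R.carrier := by
    rw [frontier_compl] at hwf
    exact frontier_closure_subset hwf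
  refine (infDist_le_dist_of_mem hwf').trans ?_
  have hsub : segment ℝ (meshPoint δ u) (meshPoint δ v) ⊆ closedBall (meshPoint δ v) δ :=
    (convex_closedBall _ _).segment_subset
      (by rw [mem_closedBall, dist_comm, Literature.Probability.Percolation.dist_meshPoint_of_adj hadj,
        abs_of_pos hδ])
      (mem_closedBall_self hδ.le)
  have := hsub hw
  rwa [mem_closedBall, dist_comm] at this

/-! ### The closest-arc rule along the side -/

/-- The tail arc is a nonempty compact part of the frontier (for `s ≤ mark 3`). [folklore] -/
theorem kwl_tailArc_compact (R : ConformalRectangle) {s : ℝ} (hs : s ≤ R.mark 3) :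
    IsCompact (tailArc R s) ∧ (tailArc R s).Nonempty ∧ tailArc R s ⊆ frontier R.carrier := by
  refine ⟨isCompact_Icc.image R.continuous_boundary, ⟨R.boundary s, s, ⟨le_rfl, hs⟩, rfl⟩, ?_⟩
  rw [← R.range_boundary]
  exact image_subset_range _ _

/-- **The closest-arc rule along the side.** Let `v` be a boundary-row vertex on the row
`nrm o v = ⌈h/δ⌉` whose foot on the side is the window point `∂Ω(u)`, `u ∈ [σ, σ']`, and
`2δ ≤ r`. Then for `s ∈ [σ, σ']`: `v ∈ rowTail R δ s ↔ s ≤ u`. (The foot is at distance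
`η = δ⌈h/δ⌉ - h < δ`; every frontier point is at distance `≥ η` — on the side by the normal
coordinate, off `B(∂Ω(u), r)` trivially — with equality only at the foot; and the foot lies on
`∂Ω[s, d]` iff `s ≤ u`, by injectivity of the loop.) [folklore] -/
theorem kwl_mem_rowTail_iff (R : ConformalRectangle) {o : Orient} {h r σ σ' : ℝ}
    (h1 : R.mark 1 < σ) (h3 : σ' < R.mark 3)
    (hcl : ∀ t ∈ Icc σ σ', ∀ z, dist z (R.boundary t) < r →
      (z ∈ closure R.carrier ↔ h ≤ Orient.nrmC o z))
    (hop : ∀ t ∈ Icc σ σ', ∀ z, dist z (R.boundary t) < r → (z ∈ R.carrier ↔ h < Orient.nrmC o z))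
    {δ : ℝ} (hδ : 0 < δ) (hδr : 2 * δ ≤ r) {v : Site 2} (hv : v ∈ boundaryRow R δ)
    (hvn : Orient.nrm o v = ⌈h / δ⌉) {u : ℝ} (hu : u ∈ Icc σ σ')
    (hfoot : R.boundary u =
      (((δ * (Orient.tng o v : ℝ) : ℝ)) : ℂ) * Orient.e o + ((h : ℝ) : ℂ) * Orient.ν o)
    {s : ℝ} (hs : s ∈ Icc σ σ') : v ∈ rowTail R δ s ↔ s ≤ u := by
  set p : ℂ := meshPoint δ v with hp
  obtain ⟨hm1, hm2⟩ := kwl_ceil_bounds (h := h) hδ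
  have htp : Orient.tngC o p = δ * (Orient.tng o v : ℝ) := Orient.tngC_meshPoint o δ v
  have hnp : Orient.nrmC o p = δ * (⌈h / δ⌉ : ℝ) := by
    rw [hp, Orient.nrmC_meshPoint, hvn]
  -- the foot and its distance `η`
  have hpu : dist p (R.boundary u) = δ * (⌈h / δ⌉ : ℝ) - h := by
    rw [hfoot, ← htp, kwl_dist_foot, hnp, abs_of_nonneg (by linarith)]
  have hη0 : 0 ≤ δ * (⌈h / δ⌉ : ℝ) - h := by linarith
  have hηδ : δ * (⌈h / δ⌉ : ℝ) - h < δ := by linarith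
  -- every frontier point is at distance `≥ η` from `p`
  have hfar : ∀ z ∈ frontier R.carrier, δ * (⌈h / δ⌉ : ℝ) - h ≤ dist p z := by
    intro z hz
    by_cases hzr : dist z (R.boundary u) < r
    · have hzn : Orient.nrmC o z = h := (kwl_mem_frontier_iff_nrmC R (hcl u hu) (hop u hu) hzr).1 hz
      calc δ * (⌈h / δ⌉ : ℝ) - h = |Orient.nrmC o p - Orient.nrmC o z| := by
            rw [hnp, hzn, abs_of_nonneg hη0]
        _ ≤ dist p z := kwl_abs_nrmC_sub_le_dist o p z
    · rw [not_lt] at hzr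
      have := dist_triangle z p (R.boundary u)
      rw [dist_comm z p] at this
      linarith
  -- the parameter range of the window lies in `[0, 1)`
  have huI : u ∈ Ico (0 : ℝ) 1 := kwl_mem_Ico_of_window R h1 h3 hu
  have hs3 : s ≤ R.mark 3 := hs.2.trans h3.le
  obtain ⟨hAc, hAne, hAf⟩ := kwl_tailArc_compact R hs3
  have hCne : (frontier R.carrier \ tailArc R s).Nonempty :=
    ⟨R.pt 0, R.pt_mem_frontier 0, pt_zero_not_mem_tailArc R (h1.le.trans hs.1)⟩
  constructor
  · -- `v ∈ rowTail s → s ≤ u`: otherwise the foot is off the tail arc and strictly nearest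
    intro hvt
    by_contra hus
    rw [not_le] at hus
    have hfoot_out : R.boundary u ∉ tailArc R s := by
      rintro ⟨t', ht', ht'u⟩
      have ht'I : t' ∈ Ico (0 : ℝ) 1 :=
        ⟨huI.1.trans (hus.le.trans ht'.1), lt_of_le_of_lt ht'.2 (R.mark_mem 3).2⟩
      have := R.injOn_boundary ht'I huI ht'u
      linarith [ht'.1]
    have hle1 : infDist p (frontier R.carrier \ tailArc R s) ≤ δ * (⌈h / δ⌉ : ℝ) - h := by
      rw [← hpu]
      exact infDist_le_dist_of_mem ⟨R.boundary_mem_frontier u, hfoot_out⟩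
    obtain ⟨z, hzA, hzd⟩ := hAc.exists_infDist_eq_dist hAne p
    have hzlt : δ * (⌈h / δ⌉ : ℝ) - h < dist p z := by
      refine lt_of_le_of_ne (hfar z (hAf hzA)) fun heq => hfoot_out ?_
      -- equality forces `z` to be the foot
      have hzr : dist z (R.boundary u) < r := by
        have := dist_triangle z p (R.boundary u)
        rw [dist_comm z p] at this
        linarith
      have hzn : Orient.nrmC o z = h := (kwl_mem_frontier_iff_nrmC R (hcl u hu) (hop u hu) hzr).1 (hAf hzA)
      have hsq := kwl_dist_sq o p z
      rw [← heq, hnp, hzn, htp] at hsq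
      have htz : Orient.tngC o z = δ * (Orient.tng o v : ℝ) := by nlinarith
      have hzeq : z = R.boundary u := by
        rw [kwl_eq_combo_of_nrmC hzn, htz, hfoot]
      rw [← hzeq]
      exact hzA
    have := ((mem_rowTail_iff R).1 hvt).2
    rw [← hp, hzd] at this
    linarith
  · -- `s ≤ u → v ∈ rowTail s`: the foot is on the tail arc
    intro hsu
    refine (mem_rowTail_iff R).2 ⟨hv, ?_⟩
    have hfoot_in : R.boundary u ∈ tailArc R s := ⟨u, ⟨hsu, hu.2.trans h3.le⟩, rfl⟩
    calc infDist p (tailArc R s) ≤ dist p (R.boundary u) := infDist_le_dist_of_mem hfoot_in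
      _ = δ * (⌈h / δ⌉ : ℝ) - h := hpu
      _ ≤ infDist p (frontier R.carrier \ tailArc R s) :=
          (le_infDist hCne).2 fun z hz => hfar z hz.1

/-! ### Where the two tails differ -/

/-- **A vertex attributed to `∂Ω[s, d]` but not to `∂Ω[s', d]` is at least as close to the window
`∂Ω([s, s'])` as to the whole frontier** (`mark 1 ≤ s ≤ s' ≤ mark 3`; elementary manipulation of
the two closest-arc inequalities with `∂Ω[s, d] = ∂Ω([s, s']) ∪ ∂Ω[s', d]`). [folklore] -/
theorem kwl_infDist_window_le (R : ConformalRectangle) {s s' : ℝ} (h1 : R.mark 1 ≤ s)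
    (hss' : s ≤ s') (h3 : s' ≤ R.mark 3) {p : ℂ}
    (hin : infDist p (tailArc R s) ≤ infDist p (frontier R.carrier \ tailArc R s))
    (hout : ¬ infDist p (tailArc R s') ≤ infDist p (frontier R.carrier \ tailArc R s')) :
    infDist p (R.boundary '' Icc s s') ≤ infDist p (frontier R.carrier) := by
  set B : Set ℂ := R.boundary '' Icc s s' with hB
  set A : Set ℂ := tailArc R s' with hA
  set C : Set ℂ := frontier R.carrier \ tailArc R s with hC
  have hsplit : tailArc R s = B ∪ A := by
    simp only [hB, hA, tailArc]
    rw [← image_union, Icc_union_Icc_eq_Icc hss' h3]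
  obtain ⟨-, hAne, hAf⟩ := kwl_tailArc_compact R h3
  obtain ⟨-, -, hsf⟩ := kwl_tailArc_compact R (hss'.trans h3)
  have hBne : B.Nonempty := ⟨R.boundary s, s, ⟨le_rfl, hss'⟩, rfl⟩
  have hCne : C.Nonempty := ⟨R.pt 0, R.pt_mem_frontier 0, pt_zero_not_mem_tailArc R h1⟩
  have hC'ne : (frontier R.carrier \ A).Nonempty :=
    ⟨R.pt 0, R.pt_mem_frontier 0, pt_zero_not_mem_tailArc R (h1.trans hss')⟩
  -- the frontier splits as `(B ∪ A) ∪ C`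
  have hF : frontier R.carrier = (B ∪ A) ∪ C := by
    rw [← hsplit, hC, Set.union_sdiff_self, Set.union_eq_self_of_subset_left hsf]
  -- `F \ A ⊆ C ∪ B`
  have hsub : frontier R.carrier \ A ⊆ C ∪ B := by
    rintro z ⟨hzF, hzA⟩
    by_cases hzB : z ∈ B
    · exact Or.inr hzB
    · exact Or.inl ⟨hzF, fun hz => by rw [hsplit] at hz; exact hz.elim hzB hzA⟩
  rw [hsplit, infDist_union_eq_min hBne hAne] at hin
  have hout' : min (infDist p C) (infDist p B) < infDist p A := by
    rw [← infDist_union_eq_min hCne hBne]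
    exact lt_of_le_of_lt (infDist_le_infDist_of_subset hsub hC'ne) (not_le.1 hout)
  rw [hF, infDist_union_eq_min (hBne.mono subset_union_left) hCne, infDist_union_eq_min hBne hAne]
  rcases le_or_gt (infDist p B) (infDist p C) with hbc | hcb
  · rw [min_eq_right hbc] at hout'
    rw [min_eq_left hout'.le, min_eq_left hbc]
  · rw [min_eq_left hcb.le] at hout'
    exfalso
    rcases min_le_iff.1 hin with h' | h'
    · linarith
    · linarith

end Summit.CriticalPhenomena.CardyFormulaZ2.Cruxes.RectilinearCardy.ExcursionKernelCovariance

end
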